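import Summits.CriticalPhenomena.PercolationContinuityZ3.Theorems.FK.MagnetizationFieldDerivative
import Summits.CriticalPhenomena.PercolationContinuityZ3.Theorems.FK.NonzeroFieldGibbsUniqueness
import Literature.Probability.LatticeModels.MagnetizationExponentUpperAFe
import Literature.Probability.LatticeModels.MeanFieldBoundGHS
import HarnessLib

/-!
# SATURATION IS NEVER ATTAINED AT FINITE FIELD: `|⟨σ_y⟩_Λ| < 1`, `|m(β,h)| < 1`, `σ²(β,h) ≥ 1 − m(β,h)² > 0`;
# `m(β,·)` IS STRICTLY INCREASING AND `ψ(β,·)` STRICTLY CONVEX ON `[0,∞)` (Friedli–Velenik 2017, §3.7; Ellis 2006, V.7)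

Claimed R42 (8)(c) in the cell INBOX at 2026-08-29T02:34:07Z by fkp-10a gen 357 (NEW CLAIM of the gen, the sixth row asked this gen), addressed to coordinator fk-4 gen 288 (seated 01:00Z 2026-08-29 by l.8634; R160 – R164 in force); lineage row FO-10a-g357s2 (self-suggested), package g357-saturation, label SA-B.
Helper file of the `fk-continuity` build cell (bschramm lane; `--supports stmt-CriticalPhenomena-4575`); builds on
p205010 (kernel theorem, internal audit signed; external expert review pending). No definitions, no named facts, no
sorries; standard axioms. UNCONDITIONAL (nearest-neighbour Ising model on `ℤ^d`; finite-volume part on any locally finite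
graph with any boundary condition and any real `β, h`).

The companion file `FieldSaturation` shows `m(β,h) → 1` as `h → ∞` (and as `β → ∞` at `h > 0`). Here: the saturation
value is never attained, and the magnetisation separates fields.

* `isingCorr_singleton_lt_one`, `neg_one_lt_isingCorr_singleton`, `abs_isingCorr_singleton_lt_one` — in every finite
  volume, for every boundary condition and all real `β, h`: `|⟨σ_y⟩^{bc}_{Λ;β,h}| < 1` for `y ∈ Λ` (the all-`∓`
  configuration has positive Boltzmann weight; the tree's `gksExpect_spinAt_lt_one` and the spin flip `isingCorr_flip_holds`);
* **`magnetizationInField_lt_one`**, `neg_one_lt_magnetizationInField`, **`abs_magnetizationInField_lt_one`** — for `β ≥ 0`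
  and EVERY real `h`: `−1 < ⟨σ_0⟩⁻_{B(0);β,h} ≤ m(β,h) ≤ ⟨σ_0⟩⁺_{B(0);β,h} < 1` (the infinite-volume `±` magnetisations are
  squeezed by the one-site boxes, `plusCorr_singleton_le_isingCorr_plus_box` / `isingCorr_minus_box_singleton_le_minusCorr`);
  `spontaneousMagnetization_lt_one`;
* **`one_sub_sq_le_tsum_plusTruncated`**, **`tsum_plusTruncated_pos`** — for `β > 0`, `h > 0`:
  `σ²(β,h) = Σ'_z ⟨σ_0;σ_z⟩⁺_{β,h} ≥ ⟨σ_0;σ_0⟩⁺ = 1 − m(β,h)² > 0` (GKS II termwise, the diagonal term);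
* **`strictMonoOn_magnetizationInField`** — for `β > 0`, `h ↦ m(β,h)` is STRICTLY increasing on `[0,∞)` (lower chord
  bound `β σ²(β,h') ≤ (m(h') − m(h))/(h' − h)`, Ellis V.7.4 (a), with `σ² > 0`); `spontaneousMagnetization_lt_magnetizationInField`
  (`m*(β) < m(β,h)` for `h > 0`), `magnetizationInField_injOn`;
* **`strictConvexOn_pressure_field_Ici`** — for `d ≥ 1`, `β > 0`, `ψ(β,·)` is STRICTLY convex on `[0,∞)` (its derivative
  `β m(β,·)` on `(0,∞)`, `deriv_pressure_field`, is strictly increasing); `strictConvexOn_pressure_field_Iic` by the symmetry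
  `ψ(β,−h) = ψ(β,h)`.

## References

* S. Friedli, Y. Velenik, *Statistical Mechanics of Lattice Systems*, CUP (2017), §3.7.3, Thm. 3.43, Cor. 3.44,
  Exercise 3.15. [FriedliVelenik2017]
* R. S. Ellis, *Entropy, Large Deviations, and Statistical Mechanics*, Springer (2006), Lemma V.7.4, Thm. V.7.5.
  [Ellis2006]
* R. B. Griffiths, C. A. Hurst, S. Sherman, *Concavity of magnetization of an Ising ferromagnet in a positive external
  field*, J. Math. Phys. 11 (1970) 790–795. [GriffithsHurstSherman1970]
-/

noncomputable section

namespace Summit.CriticalPhenomena.PercolationContinuityZ3.Theorems.FK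

namespace IsingSusceptibility

open MeasureTheory Filter Topology Finset Set
open Literature.Probability.LatticeModels
open scoped symmDiff
open Summit.CriticalPhenomena.PercolationContinuityZ3.Theorems.FK.IsingCLT

section FiniteVolume

variable {V : Type*} [DecidableEq V] (G : SimpleGraph V) [G.LocallyFinite]

/-- **`⟨σ_y⟩^{bc}_{Λ;β,h} < 1` for `y ∈ Λ`**, in every finite volume, for every boundary condition and all real `β, h`
(the all-minus configuration inside `Λ` has positive Boltzmann weight). [cite: FriedliVelenik2017, §3.1, eq. (3.8) and §3.8.1, p. 141] -/
theorem isingCorr_singleton_lt_one (Λ : Finset V) (β h : ℝ) (bc : BoundaryCondition V) {y : V} (hy : y ∈ Λ) :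
    isingCorr G Λ β h bc {y} < 1 := by
  rw [isingCorr_singleton_eq_gksExpect G Λ β h bc hy]
  exact gksExpect_spinAt_lt_one _ _ _ _

/-- **`−1 < ⟨σ_y⟩^{bc}_{Λ;β,h}` for `y ∈ Λ`** (spin flip: `⟨σ_y⟩^{bc}_{Λ;β,h} = −⟨σ_y⟩^{−bc}_{Λ;β,−h} > −1`).
[cite: FriedliVelenik2017, §3.7.1 and Exercise 3.4] -/
theorem neg_one_lt_isingCorr_singleton (Λ : Finset V) (β h : ℝ) (bc : BoundaryCondition V) {y : V} (hy : y ∈ Λ) :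
    -1 < isingCorr G Λ β h bc {y} := by
  have hflip := isingCorr_flip_holds G Λ β h bc (Finset.singleton_subset_iff.2 hy)
  rw [Finset.card_singleton, pow_one, neg_one_mul] at hflip
  have hlt := isingCorr_singleton_lt_one G Λ β (-h) bc.flip hy
  rw [hflip] at hlt
  linarith

/-- **`|⟨σ_y⟩^{bc}_{Λ;β,h}| < 1` for `y ∈ Λ`.** [cite: FriedliVelenik2017, §3.1, eq. (3.8)] -/
theorem abs_isingCorr_singleton_lt_one (Λ : Finset V) (β h : ℝ) (bc : BoundaryCondition V) {y : V} (hy : y ∈ Λ) :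
    |isingCorr G Λ β h bc {y}| < 1 :=
  abs_lt.2 ⟨neg_one_lt_isingCorr_singleton G Λ β h bc hy, isingCorr_singleton_lt_one G Λ β h bc hy⟩

end FiniteVolume

variable {d : ℕ}

/-! ### `|m(β,h)| < 1` at every real field -/

/-- **`m(β,h) < 1` for `β ≥ 0` and EVERY real `h`**: `m(β,h) = ⟨σ_0⟩⁺_{β,h} ≤ ⟨σ_0⟩⁺_{B(0);β,h} < 1` (the plus box
magnetisations decrease to the plus state). [cite: FriedliVelenik2017, Lemma 3.22, Thm. 3.17 and §3.7.3] -/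
theorem magnetizationInField_lt_one {β : ℝ} (hβ : 0 ≤ β) (h : ℝ) : magnetizationInField d β h < 1 := by
  rw [magnetizationInField_eq_plusCorr]
  exact (plusCorr_singleton_le_isingCorr_plus_box hβ h 0 0).trans_lt
    (isingCorr_singleton_lt_one (zdGraph d) (box d 0) β h .plus (zero_mem_box d 0))

/-- **`−1 < m(β,h)` for `β ≥ 0` and EVERY real `h`**: `−1 < ⟨σ_0⟩⁻_{B(0);β,h} ≤ ⟨σ_0⟩⁻_{β,h} ≤ ⟨σ_0⟩⁺_{β,h} = m(β,h)`.
[cite: FriedliVelenik2017, Lemma 3.23 and §3.7.3] -/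
theorem neg_one_lt_magnetizationInField {β : ℝ} (hβ : 0 ≤ β) (h : ℝ) : -1 < magnetizationInField d β h := by
  rw [magnetizationInField_eq_plusCorr]
  exact ((neg_one_lt_isingCorr_singleton (zdGraph d) (box d 0) β h .minus (zero_mem_box d 0)).trans_le
    (isingCorr_minus_box_singleton_le_minusCorr hβ h 0 0)).trans_le (minusCorr_singleton_le_plusCorr_singleton hβ h 0)

/-- **`|m(β,h)| < 1` for `β ≥ 0` and every real `h`**: the saturation values `±1` are attained only in the limits
`h → ±∞`. [cite: FriedliVelenik2017, §3.7.3 and Exercise 3.15] -/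
theorem abs_magnetizationInField_lt_one {β : ℝ} (hβ : 0 ≤ β) (h : ℝ) : |magnetizationInField d β h| < 1 :=
  abs_lt.2 ⟨neg_one_lt_magnetizationInField hβ h, magnetizationInField_lt_one hβ h⟩

/-- **`m*(β) < 1` for every `β ≥ 0`**: the spontaneous magnetisation is never saturated. [cite: FriedliVelenik2017, §3.7.2 and §3.10.1] -/
theorem spontaneousMagnetization_lt_one {β : ℝ} (hβ : 0 ≤ β) : spontaneousMagnetization d β < 1 := by
  rw [← magnetizationInField_zero]
  exact magnetizationInField_lt_one hβ 0

/-! ### `σ²(β,h) ≥ 1 − m(β,h)² > 0` -/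

/-- **`1 − m(β,h)² ≤ σ²(β,h) = Σ'_z (⟨σ_{{0}∆{z}}⟩⁺ − ⟨σ_0⟩⁺⟨σ_z⟩⁺)`** for `β > 0`, `h > 0`: the diagonal term `z = 0`
is `⟨σ_∅⟩⁺ − (⟨σ_0⟩⁺)² = 1 − m²`, and every other term is `≥ 0` by GKS II (`σ²(β,h) < ∞` at `h > 0`,
`summable_plusTruncated_of_pos_field`). [cite: Ellis2006, Lemma V.7.4 (a); FriedliVelenik2017, Thm. 3.20, eq. (3.22)] -/
theorem one_sub_sq_le_tsum_plusTruncated {β h : ℝ} (hβ : 0 < β) (hh : 0 < h) :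
    1 - magnetizationInField d β h ^ 2 ≤
      ∑' z : Site d, (plusCorr d β h ({0} ∆ {z}) - plusCorr d β h {0} * plusCorr d β h {z}) := by
  have h0 : plusCorr d β h ({0} ∆ {0}) - plusCorr d β h {0} * plusCorr d β h {0} = 1 - magnetizationInField d β h ^ 2 := by
    rw [symmDiff_self, Finset.bot_eq_empty, plusCorr_empty hβ.le hh.le, magnetizationInField_eq_plusCorr, sq]
  rw [← h0]
  exact (summable_plusTruncated_of_pos_field hβ hh).le_tsum 0 fun z _ =>
    sub_nonneg.2 (plusCorr_mul_le hβ.le hh.le {0} {z})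

/-- **`σ²(β,h) > 0`** for `β > 0`, `h > 0` (`σ² ≥ 1 − m² > 0` as `|m| < 1`). [cite: Ellis2006, Lemma V.7.4 (a) and Thm. V.7.5] -/
theorem tsum_plusTruncated_pos {β h : ℝ} (hβ : 0 < β) (hh : 0 < h) :
    0 < ∑' z : Site d, (plusCorr d β h ({0} ∆ {z}) - plusCorr d β h {0} * plusCorr d β h {z}) := by
  have h1 := abs_lt.1 (abs_magnetizationInField_lt_one (d := d) hβ.le h)
  have hsq : magnetizationInField d β h ^ 2 < 1 := by nlinarith [h1.1, h1.2]
  linarith [one_sub_sq_le_tsum_plusTruncated (d := d) hβ hh]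

/-! ### Strict monotonicity of `m(β,·)` and strict convexity of `ψ(β,·)` on `[0,∞)` -/

/-- **`m(β,·)` IS STRICTLY INCREASING ON `[0,∞)`** (`β > 0`): for `0 ≤ h < h'`,
`m(h') − m(h) ≥ β σ²(β,h') (h' − h) > 0` (lower chord bound, Ellis V.7.4 (a), and `σ²(β,h') > 0`).
[cite: Ellis2006, Lemma V.7.4 (a), eqs. (5.28)–(5.30); FriedliVelenik2017, Exercise 3.15] -/
theorem strictMonoOn_magnetizationInField {β : ℝ} (hβ : 0 < β) :
    StrictMonoOn (fun t => magnetizationInField d β t) (Ici 0) := by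
  intro h hh h' _ hlt
  have hs := le_slope_magnetizationInField (d := d) hβ (mem_Ici.1 hh) hlt
  rw [slope_def_field] at hs
  have hpos : 0 < β * ∑' z : Site d, (plusCorr d β h' ({0} ∆ {z}) - plusCorr d β h' {0} * plusCorr d β h' {z}) :=
    mul_pos hβ (tsum_plusTruncated_pos hβ ((mem_Ici.1 hh).trans_lt hlt))
  have hq := hpos.trans_le hs
  have hden : 0 < h' - h := sub_pos.2 hlt
  have := (div_pos_iff_of_pos_right hden).1 hq
  linarith

/-- **`m*(β) < m(β,h)` for every `h > 0`** (`β > 0`). [cite: Ellis2006, Lemma V.7.4 (a); FriedliVelenik2017, Exercise 3.15] -/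
theorem spontaneousMagnetization_lt_magnetizationInField {β h : ℝ} (hβ : 0 < β) (hh : 0 < h) :
    spontaneousMagnetization d β < magnetizationInField d β h := by
  rw [← magnetizationInField_zero]
  exact strictMonoOn_magnetizationInField hβ (mem_Ici.2 le_rfl) (mem_Ici.2 hh.le) hh

/-- The magnetisation separates nonnegative fields: `h ↦ m(β,h)` is injective on `[0,∞)` (`β > 0`).
[cite: Ellis2006, Lemma V.7.4 (a)] -/
theorem magnetizationInField_injOn {β : ℝ} (hβ : 0 < β) : InjOn (fun t => magnetizationInField d β t) (Ici 0) :=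
  (strictMonoOn_magnetizationInField hβ).injOn

/-- **`ψ(β,·)` IS STRICTLY CONVEX ON `[0,∞)`** (`d ≥ 1`, `β > 0`): `ψ(β,·)` is continuous, differentiable on `(0,∞)` with
derivative `β m(β,·)` (`deriv_pressure_field`), which is strictly increasing there. [cite: FriedliVelenik2017, Thm. 3.43 and Cor. 3.44; Ellis2006, Thm. V.7.5] -/
theorem strictConvexOn_pressure_field_Ici (hd : 1 ≤ d) {β : ℝ} (hβ : 0 < β) :
    StrictConvexOn ℝ (Ici 0) (fun t => pressure d β t) := by
  refine StrictMonoOn.strictConvexOn_of_deriv (convex_Ici 0) (continuous_pressure_field (d := d) β).continuousOn ?_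
  rw [interior_Ici]
  intro a ha b hb hab
  rw [deriv_pressure_field hd hβ.le ha, deriv_pressure_field hd hβ.le hb]
  exact mul_lt_mul_of_pos_left
    (strictMonoOn_magnetizationInField hβ (mem_Ici.2 (le_of_lt ha)) (mem_Ici.2 (le_of_lt hb)) hab) hβ

/-- **`ψ(β,·)` is strictly convex on `(−∞,0]`** as well (`ψ(β,−h) = ψ(β,h)`). [cite: FriedliVelenik2017, §3.7.1 and Cor. 3.44] -/
theorem strictConvexOn_pressure_field_Iic (hd : 1 ≤ d) {β : ℝ} (hβ : 0 < β) :
    StrictConvexOn ℝ (Iic 0) (fun t => pressure d β t) := by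
  have hIci := strictConvexOn_pressure_field_Ici (d := d) hd hβ
  refine ⟨convex_Iic 0, fun x hx y hy hxy a b ha hb hab => ?_⟩
  have key := hIci.2 (mem_Ici.2 (neg_nonneg.2 (mem_Iic.1 hx))) (mem_Ici.2 (neg_nonneg.2 (mem_Iic.1 hy)))
    (fun hne => hxy (neg_injective hne)) ha hb hab
  simp only [smul_eq_mul, pressure_neg_field] at key
  have harg : a * -x + b * -y = -(a * x + b * y) := by ring
  rw [harg, pressure_neg_field] at key
  simpa only [smul_eq_mul] using key

end IsingSusceptibility

end Summit.CriticalPhenomena.PercolationContinuityZ3.Theorems.FK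

end
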